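import Literature.Topology.FourManifolds.DehnSurgeryFramingProofs
import Literature.Topology.FourManifolds.DehnSurgeryTubularNbhdProofs
import Literature.Topology.FourManifolds.KnotsProofs
import Mathlib.Topology.Homotopy.Product
import HarnessLib

/-!
# Twisting a tubular neighbourhood: every framing of a knot is realised

Sibling proof file of `DehnSurgery.lean` (D-0014: named facts `def X : Prop` are discharged as
`theorem X_holds : X`). It discharges

* `Literature.Knot.exists_tubularNbhd_hasFraming_holds : Knot.exists_tubularNbhd_hasFraming` — for every
  smooth knot `K : 𝕊¹ → 𝕊³` and every integer `m` there is an oriented tubular neighbourhood of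
  `K` with framing `m` (Rolfsen, *Knots and Links* (1976), §9.F; Gompf–Stipsicz, *4-Manifolds
  and Kirby Calculus* (1999), §4.5: the framings of a knot form a `ℤ`-torsor, acted on by the
  twists `(x, w) ↦ (x, xᵏ · w)` of the normal bundle `𝕊¹ × ℝ²`),

in the sharper form needed for Dehn surgery on a *link* (`Literature.Topology.FourManifolds.FramedLink.exists_isSurgery`,
`KirbyMovesSurgery.lean`), where the tubular neighbourhoods of the components must in addition
stay pairwise disjoint:

* `Literature.Knot.TubularNbhd.exists_hasFraming_range_eq ν m` — **every oriented tubular neighbourhood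
  `ν` of a knot can be re-framed to any framing `m` without changing its image**:
  `∃ ν', range ν' = range ν ∧ ν'.HasFraming m`.

## Proof

* `Literature.fibreRot σ u w = u₀ w + σ u₁ J w` (`J (w₀, w₁) = (-w₁, w₀)`): for `u ∈ 𝕊¹` and `σ = ±1`
  the rotation of `ℝ²` by `±` the angle of `u` (complex multiplication by `u`, resp. `ū`);
  `Literature.circleTwist σ : 𝕊¹ × ℝ² ≅ 𝕊¹ × ℝ²`, `(x, w) ↦ (x, fibreRot σ x w)`, a diffeomorphism with
  inverse `circleTwist (-σ)`.
* `Literature.Knot.TubularNbhd.twist ν σ = ν ∘ circleTwist σ` is again an oriented tubular neighbourhood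
  of the same knot with the same image: a smooth embedding (the tree's
  `Manifold.IsSmoothEmbedding.comp_diffeomorph`), equal to `K` on the zero section, and positively
  oriented — in the coordinates `(θ, w)` of `det_pos` its Jacobian frame at `(θ, w)` is the frame
  of `ν` at `(θ, R_{σθ} w)` with the two fibre rows rotated by `R_{σθ}` (determinant
  `cos² + σ² sin² = 1`) and a combination of the fibre rows added to the `θ`-row
  (`frameDet_row_add`, `frameDet_comb₂`), so `det_pos` is that of `ν` (`tubeFrameDet`,
  `tubeFrameDet_eq_det_deriv` of `DehnSurgeryTubularNbhdProofs.lean`).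
* `Literature.Topology.FourManifolds.Knot.TubularNbhd.HasFraming.twist`: **twisting by `σ = ±1` shifts the framing by `σ`.**
  With the torus map `f (x, u) = ν (x, u/2)` into the knot complement and the standard loop `ω`
  of `𝕊¹`, the longitude of `ν` is `f ∘ (ω, pt)`, the meridian of `ν` and of `ν.twist σ` is
  `f ∘ (pt, ω)`, and the longitude of `ν.twist σ` is `f ∘ (ω, ω^{±1})`; in `π₁(𝕊¹ × 𝕊¹)` one has
  `[(ω, ω^{±1})] = [(ω, pt)] · [(pt, ω)]^{±1}` (`Path.Homotopic.Quotient.prod`,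
  `comp_prod_eq_prod_comp`), whence `[λ'] = [λ] + σ [μ] = (m + σ) [μ]` in `H₁(S³ ∖ K)`
  (transport of loop classes along `f` by the tree's `FundamentalGroup.mapOfEq_fromPath_eq`, and
  along the identity of the complement to move the base point).
* Iterating from the framing integer `m₀` of a given `ν` (`Knot.TubularNbhd.exists_hasFraming`,
  `DehnSurgeryFramingProofs.lean`) reaches every `m : ℤ` (induction on `m - m₀`).

## References

* D. Rolfsen, *Knots and Links*, Publish or Perish (1976), §9.F (framed surgery; the choice of
  the homeomorphism `S¹ × D² → N` up to twists). [cite: Rolfsen1976, §9.F]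
* R. E. Gompf, A. I. Stipsicz, *4-Manifolds and Kirby Calculus*, GSM 20 (1999), §4.5 (framings
  of a knot in `S³` correspond to integers). [cite: GompfStipsicz1999, §4.5]
* A. Hatcher, *Algebraic Topology* (2002), Prop. 1.12 (`π₁(X × Y) ≅ π₁(X) × π₁(Y)`).
  [cite: HatcherAT2002, Prop. 1.12]

## Design notes

* The finite-dimensionality `Fact`s of `DehnSurgeryTubularNbhdProofs.lean` are used as local
  instances (for `contMDiff_coe_sphere` on `𝕊¹ ⊆ ℝ²`, `𝕊³ ⊆ ℝ⁴`), as there; no global instance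
  is registered.
* No declaration in this file uses `sorry`.
-/

open scoped Manifold ContDiff Topology
open Function Set

noncomputable section

namespace Literature.Topology.FourManifolds

/-- Local notation: `𝔼 n` is the model Euclidean space `EuclideanSpace ℝ (Fin n)`. -/
local notation "𝔼 " n:arg => EuclideanSpace ℝ (Fin n)

/-- Local notation: `𝕊 n` is the unit sphere in `EuclideanSpace ℝ (Fin (n + 1))`. -/
local notation "𝕊 " n:arg => (Metric.sphere (0 : EuclideanSpace ℝ (Fin (n + 1))) 1)

/-- Local notation: the model with corners of `𝕊¹ × ℝ²`. -/
local notation "𝓘₁₂" => (ModelWithCorners.prod (𝓡 1) 𝓘(ℝ, EuclideanSpace ℝ (Fin 2)))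

attribute [local instance] fact_finrank_euclideanSpace_two fact_finrank_euclideanSpace_four

/-! ### The quarter turn and the rotations `fibreRot σ u` of the plane -/

/-- The quarter turn `J (w₀, w₁) = (-w₁, w₀)` of `ℝ²` (multiplication by `i`). [folklore] -/
def quarterRot (w : 𝔼 2) : 𝔼 2 := !₂[-w 1, w 0]

/-- First coordinate of the quarter turn. [folklore] -/
@[simp] theorem quarterRot_apply_zero (w : 𝔼 2) : quarterRot w 0 = -w 1 := rfl

/-- Second coordinate of the quarter turn. [folklore] -/
@[simp] theorem quarterRot_apply_one (w : 𝔼 2) : quarterRot w 1 = w 0 := rfl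

/-- The quarter turn is additive. [folklore] -/
theorem quarterRot_add (w w' : 𝔼 2) : quarterRot (w + w') = quarterRot w + quarterRot w' := by
  ext i
  fin_cases i
  · simp; ring
  · simp

/-- The quarter turn is homogeneous. [folklore] -/
theorem quarterRot_smul (r : ℝ) (w : 𝔼 2) : quarterRot (r • w) = r • quarterRot w := by
  ext i; fin_cases i <;> simp

/-- The quarter turn of `0` is `0`. [folklore] -/
@[simp] theorem quarterRot_zero : quarterRot 0 = 0 := by
  ext i; fin_cases i <;> simp

/-- Two quarter turns are a half turn. [folklore] -/
theorem quarterRot_quarterRot (w : 𝔼 2) : quarterRot (quarterRot w) = -w := by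
  ext i; fin_cases i <;> simp

/-- The quarter turn of the first basis vector is the second. [folklore] -/
theorem quarterRot_single_zero :
    quarterRot (EuclideanSpace.single 0 (1 : ℝ)) = EuclideanSpace.single 1 (1 : ℝ) := by
  ext i; fin_cases i <;> simp

/-- The quarter turn of the second basis vector is minus the first. [folklore] -/
theorem quarterRot_single_one :
    quarterRot (EuclideanSpace.single 1 (1 : ℝ)) = -EuclideanSpace.single 0 (1 : ℝ) := by
  ext i; fin_cases i <;> simp

/-- The quarter turn is `C^∞` (it is linear). [folklore] -/
theorem contDiff_quarterRot : ContDiff ℝ ∞ quarterRot := by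
  unfold quarterRot
  apply PiLp.contDiff_toLp.comp
  rw [contDiff_pi]
  intro i
  fin_cases i <;> simp <;> fun_prop

/-- **The rotation `fibreRot σ u w = u₀ • w + (σ u₁) • J w`** of `ℝ²`: for `u = (cos α, sin α)`
on the unit circle and `σ = ±1` it is the rotation by the angle `σ α`, i.e. complex
multiplication of `w` by `u` (`σ = 1`) or by `ū` (`σ = -1`); in coordinates
`(u₀ w₀ - σ u₁ w₁, σ u₁ w₀ + u₀ w₁)`. Gompf–Stipsicz (1999), §4.5 (the twists of `S¹ × D²`).
[cite: GompfStipsicz1999, §4.5] -/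
def fibreRot (σ : ℝ) (u w : 𝔼 2) : 𝔼 2 := u 0 • w + (σ * u 1) • quarterRot w

/-- Unfolding of `fibreRot`. [folklore] -/
theorem fibreRot_def (σ : ℝ) (u w : 𝔼 2) :
    fibreRot σ u w = u 0 • w + (σ * u 1) • quarterRot w := rfl

/-- First coordinate of `fibreRot`. [folklore] -/
@[simp] theorem fibreRot_apply_zero (σ : ℝ) (u w : 𝔼 2) :
    fibreRot σ u w 0 = u 0 * w 0 - σ * u 1 * w 1 := by
  simp [fibreRot]; ring

/-- Second coordinate of `fibreRot`. [folklore] -/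
@[simp] theorem fibreRot_apply_one (σ : ℝ) (u w : 𝔼 2) :
    fibreRot σ u w 1 = σ * u 1 * w 0 + u 0 * w 1 := by
  simp [fibreRot]; ring

/-- `fibreRot σ u` is additive. [folklore] -/
theorem fibreRot_add (σ : ℝ) (u w w' : 𝔼 2) :
    fibreRot σ u (w + w') = fibreRot σ u w + fibreRot σ u w' := by
  simp only [fibreRot_def, quarterRot_add, smul_add]
  abel

/-- `fibreRot σ u` is homogeneous. [folklore] -/
theorem fibreRot_smul (σ : ℝ) (u : 𝔼 2) (r : ℝ) (w : 𝔼 2) :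
    fibreRot σ u (r • w) = r • fibreRot σ u w := by
  simp only [fibreRot_def, quarterRot_smul, smul_add, smul_comm r]

/-- `fibreRot σ u 0 = 0`. [folklore] -/
@[simp] theorem fibreRot_zero (σ : ℝ) (u : 𝔼 2) : fibreRot σ u 0 = 0 := by
  simp [fibreRot_def]

/-- `fibreRot σ (1, 0)` is the identity. [folklore] -/
theorem fibreRot_circlePoint_zero (σ : ℝ) (w : 𝔼 2) :
    fibreRot σ ((circlePoint 0 : 𝕊 1) : 𝔼 2) w = w := by
  simp [fibreRot_def]

/-- **Rotating back**: `fibreRot (-σ) u (fibreRot σ u w) = (u₀² + σ² u₁²) • w`. [folklore] -/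
theorem fibreRot_neg_fibreRot (σ : ℝ) (u w : 𝔼 2) :
    fibreRot (-σ) u (fibreRot σ u w) = (u 0 ^ 2 + σ ^ 2 * u 1 ^ 2) • w := by
  ext i; fin_cases i <;> simp <;> ring

/-- On the unit circle and for `σ² = 1`, `fibreRot (-σ) u` undoes `fibreRot σ u`. [folklore] -/
theorem fibreRot_neg_fibreRot_of_sq {σ : ℝ} (hσ : σ ^ 2 = 1) (u : 𝕊 1) (w : 𝔼 2) :
    fibreRot (-σ) (u : 𝔼 2) (fibreRot σ (u : 𝔼 2) w) = w := by
  -- on the unit circle `u₀² + u₁² = ‖u‖² = 1`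
  have hu : (u : 𝔼 2) 0 ^ 2 + (u : 𝔼 2) 1 ^ 2 = 1 := by
    have h2 : ‖(u : 𝔼 2)‖ ^ 2 = (u : 𝔼 2) 0 ^ 2 + (u : 𝔼 2) 1 ^ 2 := by
      rw [EuclideanSpace.norm_eq, Real.sq_sqrt (Finset.sum_nonneg fun _ _ ↦ sq_nonneg _),
        Fin.sum_univ_two, Real.norm_eq_abs, Real.norm_eq_abs, sq_abs, sq_abs]
    rw [← h2, norm_eq_of_mem_sphere u, one_pow]
  rw [fibreRot_neg_fibreRot, hσ, one_mul, hu, one_smul]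

/-- On the unit circle and for `σ² = 1`, `fibreRot σ u` undoes `fibreRot (-σ) u`. [folklore] -/
theorem fibreRot_fibreRot_neg_of_sq {σ : ℝ} (hσ : σ ^ 2 = 1) (u : 𝕊 1) (w : 𝔼 2) :
    fibreRot σ (u : 𝔼 2) (fibreRot (-σ) (u : 𝔼 2) w) = w := by
  have h := fibreRot_neg_fibreRot_of_sq (σ := -σ) (by rw [neg_sq, hσ]) u w
  rwa [neg_neg] at h

/-- `fibreRot` is jointly `C^∞` in `(u, w)` (it is bilinear). [folklore] -/
theorem contDiff_fibreRot (σ : ℝ) : ContDiff ℝ ∞ fun p : (𝔼 2) × 𝔼 2 ↦ fibreRot σ p.1 p.2 := by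
  unfold fibreRot
  have h0 : ContDiff ℝ ∞ fun p : (𝔼 2) × 𝔼 2 ↦ p.1 0 := by fun_prop
  have h1 : ContDiff ℝ ∞ fun p : (𝔼 2) × 𝔼 2 ↦ σ * p.1 1 := by fun_prop
  exact (h0.smul contDiff_snd).add (h1.smul (contDiff_quarterRot.comp contDiff_snd))

/-- `fibreRot σ u w` is `C^∞` on `𝕊¹ × ℝ²`. [folklore] -/
theorem contMDiff_fibreRot_sphere (σ : ℝ) :
    ContMDiff 𝓘₁₂ 𝓘(ℝ, 𝔼 2) ∞ fun p : (𝕊 1) × 𝔼 2 ↦ fibreRot σ (p.1 : 𝔼 2) p.2 :=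
  (contDiff_fibreRot σ).comp_contMDiff
    ((contMDiff_coe_sphere.comp contMDiff_fst).prodMk_space contMDiff_snd)

/-! ### The twist diffeomorphisms of `𝕊¹ × ℝ²` -/

/-- **The twist `(x, w) ↦ (x, fibreRot σ x w)` of `𝕊¹ × ℝ²`** (`σ² = 1`): rotation of the fibre
over `x` by `±` the angle of `x`; a diffeomorphism with inverse the twist for `-σ`
(Gompf–Stipsicz (1999), §4.5; Rolfsen (1976), §9.F). [cite: GompfStipsicz1999, §4.5] -/
def circleTwist (σ : ℝ) (hσ : σ ^ 2 = 1) :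
    ((𝕊 1) × 𝔼 2) ≃ₘ⟮𝓘₁₂, 𝓘₁₂⟯ ((𝕊 1) × 𝔼 2) where
  toFun p := (p.1, fibreRot σ (p.1 : 𝔼 2) p.2)
  invFun p := (p.1, fibreRot (-σ) (p.1 : 𝔼 2) p.2)
  left_inv p := Prod.ext rfl (fibreRot_neg_fibreRot_of_sq hσ p.1 p.2)
  right_inv p := Prod.ext rfl (fibreRot_fibreRot_neg_of_sq hσ p.1 p.2)
  contMDiff_toFun := contMDiff_fst.prodMk (contMDiff_fibreRot_sphere σ)
  contMDiff_invFun := contMDiff_fst.prodMk (contMDiff_fibreRot_sphere (-σ))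

/-- The twist on points. [folklore] -/
@[simp] theorem circleTwist_apply (σ : ℝ) (hσ : σ ^ 2 = 1) (p : (𝕊 1) × 𝔼 2) :
    circleTwist σ hσ p = (p.1, fibreRot σ (p.1 : 𝔼 2) p.2) := rfl

/-! ### Row operations on the Jacobian frame -/

/-- Adding a combination of the last two rows to the second row does not change `frameDet`.
[folklore] -/
theorem frameDet_row_add (r₀ r₁ r₂ r₃ : 𝔼 4) (a b : ℝ) :
    frameDet r₀ (r₁ + (a • r₂ + b • r₃)) r₂ r₃ = frameDet r₀ r₁ r₂ r₃ := by
  rw [frameDet_expand, frameDet_expand]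
  simp
  ring

/-- Decomposition of `L (0, v)` along the fibre basis, for a linear map on `ℝ × ℝ²`. [folklore] -/
theorem clm_zero_prod_decomp (L : ℝ × 𝔼 2 →L[ℝ] 𝔼 4) (v : 𝔼 2) :
    L (0, v) = v 0 • L (0, EuclideanSpace.single 0 (1 : ℝ)) +
      v 1 • L (0, EuclideanSpace.single 1 (1 : ℝ)) := by
  have hv : ((0 : ℝ), v) = v 0 • ((0 : ℝ), EuclideanSpace.single 0 (1 : ℝ)) +
      v 1 • ((0 : ℝ), EuclideanSpace.single 1 (1 : ℝ)) := by
    refine Prod.ext (by simp) ?_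
    simp only [Prod.snd_add, Prod.smul_snd]
    exact euclideanSpace_two_decomp v
  rw [hv, map_add, map_smul, map_smul]

/-! ### The coordinate expression of a tubular neighbourhood and the twisted neighbourhood -/

namespace Knot.TubularNbhd

section Coord

variable {K : 𝕊 1 → 𝕊 3} (ν : Knot.TubularNbhd K)

/-- The **coordinate expression** `(θ, w) ↦ ν (circlePoint θ, w) ∈ ℝ⁴` of a tubular
neighbourhood, the map differentiated in `Knot.TubularNbhd.det_pos`. [folklore] -/
def coordMap (q : ℝ × 𝔼 2) : 𝔼 4 := ((ν (circlePoint q.1, q.2) : 𝕊 3) : 𝔼 4)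

/-- Unfolding of `coordMap`. [folklore] -/
theorem coordMap_apply (θ : ℝ) (w : 𝔼 2) :
    ν.coordMap (θ, w) = ((ν (circlePoint θ, w) : 𝕊 3) : 𝔼 4) := rfl

/-- The coordinate expression is `C^∞`. [folklore] -/
theorem contDiff_coordMap : ContDiff ℝ ∞ ν.coordMap := by
  have hP : ContMDiff 𝓘(ℝ, ℝ × 𝔼 2) 𝓘₁₂ ∞ (fun q : ℝ × 𝔼 2 ↦ (circlePoint q.1, q.2)) :=
    (contMDiff_circlePoint.comp contDiff_fst.contMDiff).prodMk contDiff_snd.contMDiff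
  have h : ContMDiff 𝓘(ℝ, ℝ × 𝔼 2) 𝓘(ℝ, 𝔼 4) ∞ ν.coordMap :=
    contMDiff_coe_sphere.comp (ν.contMDiff.comp hP)
  exact contMDiff_iff_contDiff.1 h

/-- The coordinate expression is differentiable. [folklore] -/
theorem differentiable_coordMap : Differentiable ℝ ν.coordMap :=
  ν.contDiff_coordMap.differentiable (by simp)

/-- `det_pos` of `ν` says that the Jacobian frame determinant of the coordinate expression is
positive. [folklore] -/
theorem tubeFrameDet_coordMap_pos (θ : ℝ) (w : 𝔼 2) : 0 < tubeFrameDet ν.coordMap (θ, w) := by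
  rw [tubeFrameDet_eq_det_deriv ν.differentiable_coordMap]
  exact ν.det_pos θ w

/-- Derivative of the coordinate expression along a line in the fibre. [folklore] -/
theorem deriv_coordMap_line (θ : ℝ) (w v : 𝔼 2) :
    deriv (fun r : ℝ ↦ ν.coordMap (θ, w + r • v)) 0 = fderiv ℝ ν.coordMap (θ, w) (0, v) := by
  have hc : HasDerivAt (fun r : ℝ ↦ (θ, w + r • v)) ((0 : ℝ), v) 0 := by
    have h1 : HasDerivAt (fun r : ℝ ↦ w + r • v) v 0 := by
      simpa using ((hasDerivAt_id (0 : ℝ)).smul_const v).const_add w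
    exact (hasDerivAt_const (0 : ℝ) θ).prodMk h1
  have hG : HasFDerivAt ν.coordMap (fderiv ℝ ν.coordMap (θ, w)) (θ, w + (0 : ℝ) • v) := by
    rw [zero_smul, add_zero]
    exact (ν.differentiable_coordMap _).hasFDerivAt
  exact (hG.comp_hasDerivAt (0 : ℝ) hc).deriv

/-- The velocity `∂_θ (R_{σθ} w) = -sin θ • w + σ cos θ • J w` of the twisted fibre
coordinate. [folklore] -/
theorem hasDerivAt_fibreRot_circlePoint (σ θ : ℝ) (w : 𝔼 2) :
    HasDerivAt (fun t : ℝ ↦ fibreRot σ ((circlePoint t : 𝕊 1) : 𝔼 2) w)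
      ((-Real.sin θ) • w + (σ * Real.cos θ) • quarterRot w) θ := by
  have h : (fun t : ℝ ↦ fibreRot σ ((circlePoint t : 𝕊 1) : 𝔼 2) w) =
      fun t ↦ Real.cos t • w + (σ * Real.sin t) • quarterRot w := by
    funext t; rfl
  rw [h]
  exact ((Real.hasDerivAt_cos θ).smul_const w).add
    (((Real.hasDerivAt_sin θ).const_mul σ).smul_const (quarterRot w))

/-- Derivative of the coordinate expression along the twisted `θ`-curve
`t ↦ (t, R_{σt} w)`. [folklore] -/
theorem deriv_coordMap_twistCurve (σ θ : ℝ) (w : 𝔼 2) :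
    deriv (fun t : ℝ ↦ ν.coordMap (t, fibreRot σ ((circlePoint t : 𝕊 1) : 𝔼 2) w)) θ =
      fderiv ℝ ν.coordMap (θ, fibreRot σ ((circlePoint θ : 𝕊 1) : 𝔼 2) w) (1, 0) +
      fderiv ℝ ν.coordMap (θ, fibreRot σ ((circlePoint θ : 𝕊 1) : 𝔼 2) w)
        (0, (-Real.sin θ) • w + (σ * Real.cos θ) • quarterRot w) := by
  set γ : ℝ → ℝ × 𝔼 2 := fun t ↦ (t, fibreRot σ ((circlePoint t : 𝕊 1) : 𝔼 2) w) with hγ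
  have hc : HasDerivAt γ ((1 : ℝ), (-Real.sin θ) • w + (σ * Real.cos θ) • quarterRot w) θ :=
    (hasDerivAt_id θ).prodMk (hasDerivAt_fibreRot_circlePoint σ θ w)
  have hγθ : γ θ = (θ, fibreRot σ ((circlePoint θ : 𝕊 1) : 𝔼 2) w) := rfl
  have hG : HasFDerivAt ν.coordMap (fderiv ℝ ν.coordMap (γ θ)) (γ θ) :=
    (ν.differentiable_coordMap _).hasFDerivAt
  have h := (hG.comp_hasDerivAt θ hc).deriv
  change deriv (ν.coordMap ∘ γ) θ = _
  rw [h, hγθ, ← map_add]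
  congr 1
  ext <;> simp

end Coord

section Twist

variable {K : 𝕊 1 → 𝕊 3} (ν : Knot.TubularNbhd K) (σ : ℝ) (hσ : σ ^ 2 = 1)

/-- **The twisted tubular neighbourhood** `ν.twist σ = ν ∘ circleTwist σ` (`σ² = 1`):
`(x, w) ↦ ν (x, R_{±angle x} w)`. It is again an oriented tubular neighbourhood of the same knot:
a smooth embedding extending `K` on the zero section, and positively oriented — its Jacobian
frame at `(θ, w)` is the frame of `ν` at `(θ, R_{σθ} w)` with the fibre rows rotated by `R_{σθ}`
(determinant `cos² θ + σ² sin² θ = 1`) and a combination of them added to the `θ`-row. Its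
longitude winds `σ` more times around `K` than that of `ν` (`HasFraming.twist`).
Gompf–Stipsicz (1999), §4.5; Rolfsen (1976), §9.F. [cite: GompfStipsicz1999, §4.5] -/
def twist : Knot.TubularNbhd K where
  toFun p := ν (p.1, fibreRot σ (p.1 : 𝔼 2) p.2)
  isSmoothEmbedding := by
    have : (fun p : (𝕊 1) × 𝔼 2 ↦ ν (p.1, fibreRot σ (p.1 : 𝔼 2) p.2)) =
        ⇑ν ∘ circleTwist σ hσ := by
      funext p; rfl
    rw [this]
    exact ν.isSmoothEmbedding_coe.comp_diffeomorph (circleTwist σ hσ)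
  apply_zero x := by
    change ν (x, fibreRot σ (x : 𝔼 2) 0) = K x
    rw [fibreRot_zero, ν.coe_apply_zero]
  det_pos θ w := by
    -- notation
    set G := ν.coordMap with hGdef
    set w' : 𝔼 2 := fibreRot σ ((circlePoint θ : 𝕊 1) : 𝔼 2) w with hw'
    set L : ℝ × 𝔼 2 →L[ℝ] 𝔼 4 := fderiv ℝ G (θ, w') with hL
    set e₀ : 𝔼 2 := EuclideanSpace.single 0 (1 : ℝ) with he₀
    set e₁ : 𝔼 2 := EuclideanSpace.single 1 (1 : ℝ) with he₁
    set v₁ : 𝔼 2 := (-Real.sin θ) • w + (σ * Real.cos θ) • quarterRot w with hv₁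
    -- the three derivative rows
    have h1 : deriv (fun t : ℝ ↦ G (t, fibreRot σ ((circlePoint t : 𝕊 1) : 𝔼 2) w)) θ =
        L (1, 0) + (v₁ 0 • L (0, e₀) + v₁ 1 • L (0, e₁)) := by
      rw [hGdef, deriv_coordMap_twistCurve, ← hGdef, ← hw', ← hL, ← hv₁, clm_zero_prod_decomp]
    have hline : ∀ i : Fin 2,
        (fun r : ℝ ↦ G (θ, fibreRot σ ((circlePoint θ : 𝕊 1) : 𝔼 2)
          (w + EuclideanSpace.single i r))) =
        fun r ↦ G (θ, w' + r • fibreRot σ ((circlePoint θ : 𝕊 1) : 𝔼 2)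
          (EuclideanSpace.single i (1 : ℝ))) := by
      intro i
      funext r
      rw [fibreRot_add, euclideanSpace_single_eq_smul i r, fibreRot_smul]
    have h2 : deriv (fun r : ℝ ↦ G (θ, fibreRot σ ((circlePoint θ : 𝕊 1) : 𝔼 2)
        (w + EuclideanSpace.single 0 r))) 0 =
        Real.cos θ • L (0, e₀) + (σ * Real.sin θ) • L (0, e₁) := by
      rw [hline 0, hGdef, deriv_coordMap_line, ← hGdef, ← hL, clm_zero_prod_decomp]
      simp [he₀, he₁]
    have h3 : deriv (fun r : ℝ ↦ G (θ, fibreRot σ ((circlePoint θ : 𝕊 1) : 𝔼 2)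
        (w + EuclideanSpace.single 1 r))) 0 =
        (-(σ * Real.sin θ)) • L (0, e₀) + Real.cos θ • L (0, e₁) := by
      rw [hline 1, hGdef, deriv_coordMap_line, ← hGdef, ← hL, clm_zero_prod_decomp]
      simp [he₀, he₁]
    -- rewrite the goal through the coordinate expression `G`
    change 0 < frameDet (G (θ, w'))
      (deriv (fun t : ℝ ↦ G (t, fibreRot σ ((circlePoint t : 𝕊 1) : 𝔼 2) w)) θ)
      (deriv (fun r : ℝ ↦ G (θ, fibreRot σ ((circlePoint θ : 𝕊 1) : 𝔼 2)
        (w + EuclideanSpace.single 0 r))) 0)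
      (deriv (fun r : ℝ ↦ G (θ, fibreRot σ ((circlePoint θ : 𝕊 1) : 𝔼 2)
        (w + EuclideanSpace.single 1 r))) 0)
    rw [h1, h2, h3, frameDet_comb₂, frameDet_row_add]
    have hdet : Real.cos θ * Real.cos θ - σ * Real.sin θ * -(σ * Real.sin θ) = 1 := by
      have h := Real.sin_sq_add_cos_sq θ
      nlinarith [hσ]
    rw [hdet, one_mul]
    exact ν.tubeFrameDet_coordMap_pos θ w'

/-- The twisted tubular neighbourhood on points. [folklore] -/
@[simp] theorem twist_apply (p : (𝕊 1) × 𝔼 2) :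
    ν.twist σ hσ p = ν (p.1, fibreRot σ (p.1 : 𝔼 2) p.2) := rfl

/-- **Twisting does not change the image** of the tubular neighbourhood. [folklore] -/
theorem range_twist : range ⇑(ν.twist σ hσ) = range ⇑ν := by
  have : ⇑(ν.twist σ hσ) = ⇑ν ∘ circleTwist σ hσ := by funext p; rfl
  rw [this, (EquivLike.surjective (circleTwist σ hσ)).range_comp]

end Twist

/-! ### Loops in the torus `𝕊¹ × 𝕊¹` -/

section Loops

/-- `circlePoint (2π · 0) = circlePoint 0`. [folklore] -/
theorem circlePoint_two_pi_mul_zero : circlePoint (2 * Real.pi * 0) = circlePoint 0 := by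
  rw [mul_zero]

/-- `circlePoint (2π · 1) = circlePoint 0`. [folklore] -/
theorem circlePoint_two_pi_mul_one : circlePoint (2 * Real.pi * 1) = circlePoint 0 := by
  rw [mul_one, ← zero_add (2 * Real.pi), circlePoint_add_two_pi]

/-- `circlePoint (-(2π))= circlePoint 0`. [folklore] -/
theorem circlePoint_neg_two_pi : circlePoint (-(2 * Real.pi)) = circlePoint 0 := by
  rw [← circlePoint_add_two_pi, neg_add_cancel]

/-- **The standard loop of the circle** `θ ↦ circlePoint (2πθ)`, based at `circlePoint 0`.
[folklore] -/
def circleLoop : Path (circlePoint 0) (circlePoint 0) where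
  toFun θ := circlePoint (2 * Real.pi * θ)
  continuous_toFun := by fun_prop
  source' := by simp only [Set.Icc.coe_zero, circlePoint_two_pi_mul_zero]
  target' := by simp only [Set.Icc.coe_one, circlePoint_two_pi_mul_one]

/-- The standard loop on points. [folklore] -/
@[simp] theorem circleLoop_apply (θ : unitInterval) : circleLoop θ = circlePoint (2 * Real.pi * θ) :=
  rfl

/-- The loop `θ ↦ circlePoint (σ · 2πθ)` of the circle for a sign `σ = ±1`: the standard loop for
`σ = 1`, its reverse for `σ = -1` (`circleLoopσ_one`, `circleLoopσ_neg_one`). [folklore] -/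
def circleLoopσ (σ : ℝ) (hσ : σ = 1 ∨ σ = -1) : Path (circlePoint 0) (circlePoint 0) where
  toFun θ := circlePoint (σ * (2 * Real.pi * θ))
  continuous_toFun := by fun_prop
  source' := by simp only [Set.Icc.coe_zero, mul_zero]
  target' := by
    rcases hσ with rfl | rfl
    · simp only [Set.Icc.coe_one, one_mul, circlePoint_two_pi_mul_one]
    · simp only [Set.Icc.coe_one, mul_one, neg_mul, one_mul, circlePoint_neg_two_pi]

/-- The signed loop on points. [folklore] -/
@[simp] theorem circleLoopσ_apply (σ : ℝ) (hσ : σ = 1 ∨ σ = -1) (θ : unitInterval) :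
    circleLoopσ σ hσ θ = circlePoint (σ * (2 * Real.pi * θ)) :=
  rfl

/-- For `σ = 1` the signed loop is the standard loop. [folklore] -/
theorem circleLoopσ_one (h : (1 : ℝ) = 1 ∨ (1 : ℝ) = -1) : circleLoopσ 1 h = circleLoop := by
  refine Path.ext (funext fun θ ↦ ?_)
  rw [circleLoopσ_apply, circleLoop_apply, one_mul]

/-- For `σ = -1` the signed loop is the reversed standard loop. [folklore] -/
theorem circleLoopσ_neg_one (h : (-1 : ℝ) = 1 ∨ (-1 : ℝ) = -1) :
    circleLoopσ (-1) h = circleLoop.symm := by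
  refine Path.ext (funext fun θ ↦ ?_)
  change circlePoint (-1 * (2 * Real.pi * θ)) =
    circlePoint (2 * Real.pi * (unitInterval.symm θ : ℝ))
  rw [unitInterval.coe_symm_eq,
    show 2 * Real.pi * (1 - (θ : ℝ)) = -1 * (2 * Real.pi * θ) + 2 * Real.pi by ring,
    circlePoint_add_two_pi]

/-- **The fundamental group of a product**: the class of a loop `(γ₁, γ₂)` of `X × Y` is the
class of `(γ₁, pt)` followed by `(pt, γ₂)` (Hatcher, *Algebraic Topology*, Prop. 1.12).
[cite: HatcherAT2002, Prop. 1.12] -/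
theorem mk_prod_eq_trans {X Y : Type*} [TopologicalSpace X] [TopologicalSpace Y] {x : X} {y : Y}
    (γ₁ : Path x x) (γ₂ : Path y y) :
    Path.Homotopic.Quotient.mk (γ₁.prod γ₂) =
      (Path.Homotopic.Quotient.mk (γ₁.prod (Path.refl y))).trans
        (Path.Homotopic.Quotient.mk ((Path.refl x).prod γ₂)) := by
  rw [← Path.Homotopic.prod_lift, ← Path.Homotopic.prod_lift, ← Path.Homotopic.prod_lift,
    Path.Homotopic.comp_prod_eq_prod_comp, Path.Homotopic.Quotient.mk_refl,
    Path.Homotopic.Quotient.mk_refl, Path.Homotopic.Quotient.trans_refl,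
    Path.Homotopic.Quotient.refl_trans]

/-- The fundamental group of a product, multiplicative form in `π₁(X × Y, (x, y))`:
`[(γ₁, γ₂)] = [(pt, γ₂)] * [(γ₁, pt)]` (Mathlib's `FundamentalGroup` multiplies
`p * q = q.trans p`). [cite: HatcherAT2002, Prop. 1.12] -/
theorem fromPath_mk_prod {X Y : Type*} [TopologicalSpace X] [TopologicalSpace Y] {x : X} {y : Y}
    (γ₁ : Path x x) (γ₂ : Path y y) :
    FundamentalGroup.fromPath (Path.Homotopic.Quotient.mk (γ₁.prod γ₂)) =
      FundamentalGroup.fromPath (Path.Homotopic.Quotient.mk ((Path.refl x).prod γ₂)) *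
        FundamentalGroup.fromPath (Path.Homotopic.Quotient.mk (γ₁.prod (Path.refl y))) := by
  rw [FundamentalGroup.mul_def]
  exact mk_prod_eq_trans γ₁ γ₂

/-- Reversing the second factor of a loop `(pt, γ)` inverts its class. [folklore] -/
theorem fromPath_mk_refl_prod_symm {X Y : Type*} [TopologicalSpace X] [TopologicalSpace Y]
    {x : X} {y : Y} (γ : Path y y) :
    FundamentalGroup.fromPath (Path.Homotopic.Quotient.mk ((Path.refl x).prod γ.symm)) =
      (FundamentalGroup.fromPath (Path.Homotopic.Quotient.mk ((Path.refl x).prod γ)))⁻¹ := by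
  have h : (Path.refl x).prod γ.symm = ((Path.refl x).prod γ).symm :=
    Path.ext (funext fun _ ↦ rfl)
  rw [h, FundamentalGroup.inv_def, Path.Homotopic.Quotient.mk_symm]

/-- **The torus identity** behind the change of framing: in `π₁(𝕊¹ × 𝕊¹)` the class of the
`(1, σ)`-curve `(ω, ω^σ)` is `[(pt, ω)]^σ * [(ω, pt)]` (`σ = ±1`, as the integer `k`).
[cite: HatcherAT2002, Prop. 1.12] -/
theorem fromPath_circleLoop_prod_circleLoopσ {σ : ℝ} (hσ : σ = 1 ∨ σ = -1) {k : ℤ}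
    (hk : (k : ℝ) = σ) :
    FundamentalGroup.fromPath (Path.Homotopic.Quotient.mk (circleLoop.prod (circleLoopσ σ hσ))) =
      FundamentalGroup.fromPath (Path.Homotopic.Quotient.mk
          ((Path.refl (circlePoint 0)).prod circleLoop)) ^ k *
        FundamentalGroup.fromPath (Path.Homotopic.Quotient.mk
          (circleLoop.prod (Path.refl (circlePoint 0)))) := by
  rw [fromPath_mk_prod]
  rcases hσ with h | h
  · subst h
    have hk1 : k = 1 := by exact_mod_cast hk
    subst hk1
    rw [circleLoopσ_one, zpow_one]
  · subst h
    have hk1 : k = -1 := by exact_mod_cast hk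
    subst hk1
    rw [circleLoopσ_neg_one, fromPath_mk_refl_prod_symm, zpow_neg_one]

end Loops

/-! ### The framing of the twisted tubular neighbourhood -/

section Framing

variable {K : Knot} (ν : Knot.TubularNbhd K)

/-- **The torus map** `f (x, u) = ν (x, u/2)` of a tubular neighbourhood: the torus of radius
`½` in the tube, inside the knot complement. The longitude of `ν` is `f ∘ (ω, pt)` and the
meridian is `f ∘ (pt, ω)` for the standard loop `ω` (by definition), and the longitude of the
twisted neighbourhood is `f ∘ (ω, ω^{±1})`. Rolfsen (1976), §9.F. [cite: Rolfsen1976, §9.F] -/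
def torusMap : C((𝕊 1) × (𝕊 1), K.complement) where
  toFun p := ⟨ν (p.1, (1 / 2 : ℝ) • (p.2 : 𝔼 2)),
    ν.apply_mem_compl_range (half_smul_coe_sphere_ne_zero p.2)⟩
  continuous_toFun := by
    refine Continuous.subtype_mk ?_ _
    fun_prop

/-- The torus map on points. [folklore] -/
theorem coe_torusMap_apply (p : (𝕊 1) × (𝕊 1)) :
    (ν.torusMap p : 𝕊 3) = ν (p.1, (1 / 2 : ℝ) • (p.2 : 𝔼 2)) := rfl

/-- The torus map sends the base point `(1, 1)` to the base point of `ν`. [folklore] -/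
theorem torusMap_base : ν.torusMap (circlePoint 0, circlePoint 0) = ν.basePoint := rfl

/-- `fibreRot σ (circlePoint s) (circlePoint 0) = circlePoint (σ s)` for `σ = ±1`. [folklore] -/
theorem fibreRot_circlePoint_circlePoint_zero {σ : ℝ} (hσ : σ = 1 ∨ σ = -1) (s : ℝ) :
    fibreRot σ ((circlePoint s : 𝕊 1) : 𝔼 2) ((circlePoint 0 : 𝕊 1) : 𝔼 2) =
      ((circlePoint (σ * s) : 𝕊 1) : 𝔼 2) := by
  rcases hσ with rfl | rfl
  · ext i; fin_cases i <;> simp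
  · ext i; fin_cases i <;> simp [Real.cos_neg, Real.sin_neg]

/-- The twisted neighbourhood evaluated on the framing base vector:
`R_{σs} e₀ = ½ circlePoint (σ s)`. [folklore] -/
theorem fibreRot_circlePoint_framingBaseVector {σ : ℝ} (hσ : σ = 1 ∨ σ = -1) (s : ℝ) :
    fibreRot σ ((circlePoint s : 𝕊 1) : 𝔼 2) framingBaseVector =
      (1 / 2 : ℝ) • ((circlePoint (σ * s) : 𝕊 1) : 𝔼 2) := by
  rw [framingBaseVector, fibreRot_smul, fibreRot_circlePoint_circlePoint_zero hσ]

variable (σ : ℝ) (hσ : σ ^ 2 = 1)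

variable {σ} in
/-- `σ² = 1` means `σ = ±1`. [folklore] -/
theorem eq_one_or_eq_neg_one_of_sq (hσ : σ ^ 2 = 1) : σ = 1 ∨ σ = -1 :=
  mul_self_eq_one_iff.1 (by rw [← sq]; exact hσ)

/-- The base point of the twisted neighbourhood is the base point of `ν`. [folklore] -/
theorem basePoint_twist : ν.basePoint = (ν.twist σ hσ).basePoint := by
  apply Subtype.ext
  change ν (circlePoint 0, framingBaseVector) =
    ν (circlePoint 0, fibreRot σ ((circlePoint 0 : 𝕊 1) : 𝔼 2) framingBaseVector)
  rw [fibreRot_circlePoint_zero]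

/-- The torus map sends the base point to the base point of the twisted neighbourhood.
[folklore] -/
theorem torusMap_base_twist :
    ν.torusMap (circlePoint 0, circlePoint 0) = (ν.twist σ hσ).basePoint := by
  rw [torusMap_base, basePoint_twist]

/-- **The meridian of the twisted neighbourhood is the meridian of `ν`** (pointwise; the twist
is the identity over the base angle). [folklore] -/
theorem meridian_twist_apply (t : unitInterval) :
    ((ν.twist σ hσ).meridian t : K.complement) = ν.meridian t := by
  apply Subtype.ext
  change ν (circlePoint 0, fibreRot σ ((circlePoint 0 : 𝕊 1) : 𝔼 2)
      ((1 / 2 : ℝ) • ((circlePoint (2 * Real.pi * t) : 𝕊 1) : 𝔼 2))) =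
    ν (circlePoint 0, (1 / 2 : ℝ) • ((circlePoint (2 * Real.pi * t) : 𝕊 1) : 𝔼 2))
  rw [fibreRot_circlePoint_zero]

/-- **The longitude of the twisted neighbourhood is the `(1, σ)`-curve** `f ∘ (ω, ω^σ)` of the
torus (pointwise). [folklore] -/
theorem longitude_twist_apply (t : unitInterval) :
    ((ν.twist σ hσ).longitude t : K.complement) =
      ν.torusMap ((circleLoop.prod (circleLoopσ σ (eq_one_or_eq_neg_one_of_sq hσ))) t) := by
  apply Subtype.ext
  change ν (circlePoint (2 * Real.pi * t),
      fibreRot σ ((circlePoint (2 * Real.pi * t) : 𝕊 1) : 𝔼 2) framingBaseVector) =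
    ν (circlePoint (2 * Real.pi * t),
      (1 / 2 : ℝ) • ((circlePoint (σ * (2 * Real.pi * t)) : 𝕊 1) : 𝔼 2))
  rw [fibreRot_circlePoint_framingBaseVector (eq_one_or_eq_neg_one_of_sq hσ)]

/-- **Twisting by `σ = ±1` shifts the framing by `σ`.** If `ν` has framing `m` then `ν.twist σ`
has framing `m + k`, where `k = σ ∈ {1, -1}` as an integer: in `π₁(S³ ∖ K)ᵃᵇ` the longitude of
the twisted neighbourhood is `[λ] + k [μ]` (image of the torus identity
`fromPath_circleLoop_prod_circleLoopσ` under the torus map), its meridian is `[μ]`, and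
`[λ] = m [μ]`. Gompf–Stipsicz (1999), §4.5; Rolfsen (1976), §9.F. [cite: GompfStipsicz1999, §4.5] -/
theorem HasFraming.twist {m : ℤ} (h : ν.HasFraming m) {k : ℤ} (hk : (k : ℝ) = σ) :
    (ν.twist σ hσ).HasFraming (m + k) := by
  have hσ' : σ = 1 ∨ σ = -1 := eq_one_or_eq_neg_one_of_sq hσ
  -- base points and the loops of the torus
  have hbb' : (ContinuousMap.id K.complement) ν.basePoint = (ν.twist σ hσ).basePoint :=
    ν.basePoint_twist σ hσ
  have hft : ν.torusMap (circlePoint 0, circlePoint 0) = (ν.twist σ hσ).basePoint :=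
    ν.torusMap_base_twist σ hσ
  set α : Path (circlePoint 0, circlePoint 0) (circlePoint 0, circlePoint 0) :=
    circleLoop.prod (Path.refl (circlePoint 0)) with hα
  set β : Path (circlePoint 0, circlePoint 0) (circlePoint 0, circlePoint 0) :=
    (Path.refl (circlePoint 0)).prod circleLoop with hβ
  set δ : Path (circlePoint 0, circlePoint 0) (circlePoint 0, circlePoint 0) :=
    circleLoop.prod (circleLoopσ σ hσ') with hδ
  -- transport along the identity of the complement, from `ν.basePoint` to the twisted base point
  set ι := FundamentalGroup.mapOfEq (ContinuousMap.id K.complement) hbb' with hι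
  have eιL : ι (FundamentalGroup.fromPath (Path.Homotopic.Quotient.mk ν.longitude)) =
      FundamentalGroup.fromPath (Path.Homotopic.Quotient.mk
        (ν.longitude.cast hbb'.symm hbb'.symm)) :=
    FundamentalGroup.mapOfEq_fromPath_eq _ hbb' _ _ fun t ↦ rfl
  have eιM : ι (FundamentalGroup.fromPath (Path.Homotopic.Quotient.mk ν.meridian)) =
      FundamentalGroup.fromPath (Path.Homotopic.Quotient.mk (ν.twist σ hσ).meridian) :=
    FundamentalGroup.mapOfEq_fromPath_eq _ hbb' _ _ fun t ↦ ν.meridian_twist_apply σ hσ t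
  -- the framing relation of `ν`, moved to the twisted base point
  have h0 : Abelianization.of (FundamentalGroup.fromPath (Path.Homotopic.Quotient.mk ν.longitude)) =
      Abelianization.of (FundamentalGroup.fromPath (Path.Homotopic.Quotient.mk ν.meridian)) ^ m := h
  have h' := congrArg (Abelianization.map ι) h0
  simp only [map_zpow, Abelianization.map_of, eιL, eιM] at h'
  -- transport along the torus map, at the twisted base point
  set g := FundamentalGroup.mapOfEq ν.torusMap hft with hg
  have egα : g (FundamentalGroup.fromPath (Path.Homotopic.Quotient.mk α)) =
      FundamentalGroup.fromPath (Path.Homotopic.Quotient.mk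
        (ν.longitude.cast hbb'.symm hbb'.symm)) :=
    FundamentalGroup.mapOfEq_fromPath_eq ν.torusMap hft α _ fun t ↦ rfl
  have egβ : g (FundamentalGroup.fromPath (Path.Homotopic.Quotient.mk β)) =
      FundamentalGroup.fromPath (Path.Homotopic.Quotient.mk (ν.twist σ hσ).meridian) :=
    FundamentalGroup.mapOfEq_fromPath_eq ν.torusMap hft β _ fun t ↦ ν.meridian_twist_apply σ hσ t
  have egδ : g (FundamentalGroup.fromPath (Path.Homotopic.Quotient.mk δ)) =
      FundamentalGroup.fromPath (Path.Homotopic.Quotient.mk (ν.twist σ hσ).longitude) :=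
    FundamentalGroup.mapOfEq_fromPath_eq ν.torusMap hft δ _ fun t ↦ ν.longitude_twist_apply σ hσ t
  -- the torus identity `[δ] = [β]^k * [α]`, pushed forward
  have htorus := fromPath_circleLoop_prod_circleLoopσ hσ' hk
  rw [← hδ, ← hβ, ← hα] at htorus
  have key := congrArg g htorus
  simp only [map_mul, map_zpow, egδ, egβ, egα] at key
  -- assemble in the abelianisation
  unfold HasFraming
  rw [key]
  simp only [map_mul, map_zpow]
  rw [h', ← zpow_add, add_comm k m]

end Framing

/-! ### Every framing is realised, without changing the image -/

section Exists

variable {K : Knot} (ν : Knot.TubularNbhd K)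

/-- One twist up: a tubular neighbourhood with the same image and framing `m + 1`. [folklore] -/
theorem exists_hasFraming_add_one {m : ℤ} (h : ν.HasFraming m) :
    ∃ ν' : Knot.TubularNbhd K, range ⇑ν' = range ⇑ν ∧ ν'.HasFraming (m + 1) :=
  ⟨ν.twist 1 (by norm_num), ν.range_twist 1 _, HasFraming.twist ν 1 (by norm_num) h (by norm_num)⟩

/-- One twist down: a tubular neighbourhood with the same image and framing `m - 1`. [folklore] -/
theorem exists_hasFraming_sub_one {m : ℤ} (h : ν.HasFraming m) :
    ∃ ν' : Knot.TubularNbhd K, range ⇑ν' = range ⇑ν ∧ ν'.HasFraming (m - 1) :=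
  ⟨ν.twist (-1) (by norm_num), ν.range_twist (-1) _, by
    rw [sub_eq_add_neg]
    exact HasFraming.twist ν (-1) (by norm_num) h (by norm_num)⟩

/-- Iterated twists: from framing `m₀` to framing `m₀ + n` and `m₀ - n`, same image. [folklore] -/
theorem exists_hasFraming_add_nat {m₀ : ℤ} (h : ν.HasFraming m₀) (n : ℕ) :
    (∃ ν' : Knot.TubularNbhd K, range ⇑ν' = range ⇑ν ∧ ν'.HasFraming (m₀ + n)) ∧
      ∃ ν' : Knot.TubularNbhd K, range ⇑ν' = range ⇑ν ∧ ν'.HasFraming (m₀ - n) := by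
  induction n with
  | zero => exact ⟨⟨ν, rfl, by simpa using h⟩, ⟨ν, rfl, by simpa using h⟩⟩
  | succ n ih =>
    obtain ⟨⟨ν₁, hr₁, h₁⟩, ⟨ν₂, hr₂, h₂⟩⟩ := ih
    refine ⟨?_, ?_⟩
    · obtain ⟨ν', hr', h'⟩ := ν₁.exists_hasFraming_add_one h₁
      exact ⟨ν', hr'.trans hr₁, by rwa [Nat.cast_succ, ← add_assoc]⟩
    · obtain ⟨ν', hr', h'⟩ := ν₂.exists_hasFraming_sub_one h₂
      exact ⟨ν', hr'.trans hr₂, by rwa [Nat.cast_succ, ← sub_sub]⟩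

/-- **Every oriented tubular neighbourhood can be re-framed to any framing without changing its
image**: for every `ν` and `m : ℤ` there is an oriented tubular neighbourhood `ν'` of the same
knot with `range ν' = range ν` and framing `m` — twist `ν` by `(x, w) ↦ (x, x^{m - m₀} · w)`,
where `m₀` is the framing integer of `ν` (`Knot.TubularNbhd.exists_hasFraming`). This is the form
of "every framing is realised" used for surgery on links, where the tubular neighbourhoods of the
components must stay pairwise disjoint. Rolfsen (1976), §9.F; Gompf–Stipsicz (1999), §4.5.
[cite: GompfStipsicz1999, §4.5] -/
theorem exists_hasFraming_range_eq (m : ℤ) :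
    ∃ ν' : Knot.TubularNbhd K, range ⇑ν' = range ⇑ν ∧ ν'.HasFraming m := by
  obtain ⟨m₀, h₀⟩ := ν.exists_hasFraming
  obtain ⟨n, hn | hn⟩ := Int.eq_nat_or_neg (m - m₀)
  · obtain ⟨⟨ν', hr, h⟩, -⟩ := ν.exists_hasFraming_add_nat h₀ n
    refine ⟨ν', hr, ?_⟩
    rwa [← hn, add_sub_cancel] at h
  · obtain ⟨-, ⟨ν', hr, h⟩⟩ := ν.exists_hasFraming_add_nat h₀ n
    refine ⟨ν', hr, ?_⟩
    rw [sub_eq_add_neg, ← hn, add_sub_cancel] at h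
    exact h

end Exists

end Knot.TubularNbhd

/-- **Every framing is realised** (discharge of the named fact
`Literature.Topology.FourManifolds.Knot.exists_tubularNbhd_hasFraming` of `DehnSurgery.lean`): for every smooth knot `K` and
every integer `m` there is an oriented tubular neighbourhood of `K` with framing `m` — twist any
tubular neighbourhood (`Knot.nonempty_tubularNbhd_holds`, Hirsch (1976), §4.5) the right number of
times (`Knot.TubularNbhd.exists_hasFraming_range_eq`). Rolfsen, *Knots and Links* (1976), §9.F;
Gompf–Stipsicz (1999), §4.5. [cite: GompfStipsicz1999, §4.5] -/
theorem Knot.exists_tubularNbhd_hasFraming_holds : Knot.exists_tubularNbhd_hasFraming := by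
  intro K m
  obtain ⟨ν⟩ := Knot.nonempty_tubularNbhd_holds K
  obtain ⟨ν', -, h⟩ := ν.exists_hasFraming_range_eq m
  exact ⟨ν', h⟩

end Literature.Topology.FourManifolds
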